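import Summits.Ventures.GridStability.Lyapunov.ConnectivityTestVector
import HarnessLib

/-!
# Rational brackets for the irrational admittance weights `‖Y_l‖ = (r_l² + x_l²)^{-1/2}` (G2-SCALE Q2, both sides)

Venture GRIDFUSION, G2-SCALE cell (lead g19 §17 (K3)/(K4)), owner gridfusion-sos-5 g9. The Q2 chains read the
network through the real weight kernel `aᵢⱼ = ‖Yᵢⱼ‖ = 1/√(rᵢⱼ² + xᵢⱼ²)` [GrossEtAl2019, eq. (1)]; the YES device
(`connectivity_certificate_of_grounded_smatIn` + `connectivity_certificate_of_le_weights`) wants rational LOWER weights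
`w⁻ ≤ a`, the NO device (`not_connectivity_certificate_of_testVector`) rational UPPER weights `a ≤ w⁺`. This file
types the impedance data ONCE as a sparse list `ZW : List (List (ℕ × ℚ × ℚ × ℚ))` — row `i` = `(j, rᵢⱼ, xᵢⱼ, qᵢⱼ)`
with the claimed rational bracket `q` — and gives: the real kernel `admittanceKernel N ZW` (what a Bench file should
use as its `‖Y‖`), the rational sparse matrix `bracketSMat ZW : SMat ℚ` (drop `r, x`), and the two ONE-decide
criteria `upperCheck` (`0 ≤ q ∧ 1 ≤ q²(r² + x²)` ⇒ `‖Y‖ ≤ q`) / `lowerCheck` (`0 ≤ q ∧ 0 < r² + x² ∧ q²(r² + x²) ≤ 1`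
⇒ `q ≤ ‖Y‖`), entrywise — lit-3's `q2_edge_weights.py` emits exactly these brackets («(w⁻)²|z|² ≤ 1», «(w⁺)²|z|² ≥ 1»).
THREE COLUMNS. CERTIFIED (kernel): everything here. VALIDATED / MODELLED: nothing.
[cite: GrossEtAl2019, eq. (1) (‖Y_jk‖ = (r_jk² + ω₀²ℓ_jk²)^{-1/2}); BarrettEtAl1994, §4.3.1 «Compressed Row Storage (CRS)», p. 57]
-/

namespace Summit.Ventures.GridStability.Lyapunov

open Finset Matrix
open Literature.MathematicalPhysics.PowerSystems
open Literature.Computation.Certificates Literature.Computation.Certificates.PSD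

/-- The admittance magnitude `‖Y‖ = 1/√(r² + x²)` of a line with resistance `r` and reactance `x`
(`= 0` by Lean's conventions when `r = x = 0`). [cite: GrossEtAl2019, eq. (1)] -/
noncomputable def admittance (r x : ℚ) : ℝ := 1 / Real.sqrt ((r : ℝ) ^ 2 + (x : ℝ) ^ 2)

/-- `admittance` is nonnegative. [cite: GrossEtAl2019, eq. (1)] -/
theorem admittance_nonneg (r x : ℚ) : 0 ≤ admittance r x :=
  div_nonneg zero_le_one (Real.sqrt_nonneg _)

/-- **Upper bracket:** `0 ≤ q` and `1 ≤ q²(r² + x²)` give `‖Y‖ ≤ q`. [cite: GrossEtAl2019, eq. (1)] -/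
theorem admittance_le_of_check (r x q : ℚ) (hq : 0 ≤ q) (h : 1 ≤ q ^ 2 * (r ^ 2 + x ^ 2)) :
    admittance r x ≤ q := by
  unfold admittance
  set s : ℝ := (r : ℝ) ^ 2 + (x : ℝ) ^ 2 with hs
  have h' : (1 : ℝ) ≤ (q : ℝ) ^ 2 * s := by rw [hs]; exact_mod_cast h
  have hs0 : 0 < s := by
    by_contra hnot
    push Not at hnot
    nlinarith [sq_nonneg (q : ℝ)]
  have hsq : 0 < Real.sqrt s := Real.sqrt_pos.2 hs0
  rw [div_le_iff₀ hsq]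
  have hq' : (0 : ℝ) ≤ q := by exact_mod_cast hq
  have hprod : 0 ≤ (q : ℝ) * Real.sqrt s := mul_nonneg hq' hsq.le
  nlinarith [Real.sq_sqrt hs0.le, sq_nonneg ((q : ℝ) * Real.sqrt s - 1)]

/-- **Lower bracket:** `0 ≤ q`, `0 < r² + x²` and `q²(r² + x²) ≤ 1` give `q ≤ ‖Y‖`. [cite: GrossEtAl2019, eq. (1)] -/
theorem le_admittance_of_check (r x q : ℚ) (hq : 0 ≤ q) (hs : 0 < r ^ 2 + x ^ 2)
    (h : q ^ 2 * (r ^ 2 + x ^ 2) ≤ 1) : (q : ℝ) ≤ admittance r x := by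
  unfold admittance
  set s : ℝ := (r : ℝ) ^ 2 + (x : ℝ) ^ 2 with hs'
  have hs0 : 0 < s := by rw [hs']; exact_mod_cast hs
  have h' : (q : ℝ) ^ 2 * s ≤ 1 := by rw [hs']; exact_mod_cast h
  have hsq : 0 < Real.sqrt s := Real.sqrt_pos.2 hs0
  rw [le_div_iff₀ hsq]
  have hq' : (0 : ℝ) ≤ q := by exact_mod_cast hq
  nlinarith [Real.sq_sqrt hs0.le, sq_nonneg ((q : ℝ) * Real.sqrt s + 1), mul_nonneg hq' hsq.le]

/-! ## The typed impedance list and its two readings -/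

/-- Impedance-and-bracket rows: row `i` = list of `(j, rᵢⱼ, xᵢⱼ, qᵢⱼ)`. [cite: GrossEtAl2019, eq. (1)] -/
abbrev ZWRows := List (List (ℕ × ℚ × ℚ × ℚ))

/-- The real admittance row of node `i`: `(j, ‖Yᵢⱼ‖)` pairs. [cite: GrossEtAl2019, eq. (1)] -/
noncomputable def admittanceRow (row : List (ℕ × ℚ × ℚ × ℚ)) : SRow ℝ :=
  row.map fun p => (p.1, admittance p.2.1 p.2.2.1)

/-- **The real weight kernel `aᵢⱼ = ‖Yᵢⱼ‖`** of the typed impedance list (what a Bench file reads as the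
network's weights). [cite: GrossEtAl2019, eq. (1)] -/
noncomputable def admittanceKernel (N : ℕ) (ZW : ZWRows) : Fin N → Fin N → ℝ :=
  fun i j => SRow.fn (admittanceRow (ZW.getD i.val [])) j.val

/-- The rational bracket matrix: `(j, qᵢⱼ)` pairs — the `W` / `Wp` of the YES / NO devices.
[cite: BarrettEtAl1994, §4.3.1, p. 57] -/
def bracketSMat (ZW : ZWRows) : SMat ℚ :=
  ZW.map fun row => row.map fun p => (p.1, p.2.2.2)

/-- Every bracket is an UPPER bracket: `0 ≤ q ∧ 1 ≤ q²(r² + x²)`. [cite: GrossEtAl2019, eq. (1)] -/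
def upperCheck (ZW : ZWRows) : Bool :=
  ZW.all fun row => row.all fun p => decide (0 ≤ p.2.2.2 ∧ 1 ≤ p.2.2.2 ^ 2 * (p.2.1 ^ 2 + p.2.2.1 ^ 2))

/-- Every bracket is a LOWER bracket: `0 ≤ q ∧ 0 < r² + x² ∧ q²(r² + x²) ≤ 1`. [cite: GrossEtAl2019, eq. (1)] -/
def lowerCheck (ZW : ZWRows) : Bool :=
  ZW.all fun row => row.all fun p =>
    decide (0 ≤ p.2.2.2 ∧ 0 < p.2.1 ^ 2 + p.2.2.1 ^ 2 ∧ p.2.2.2 ^ 2 * (p.2.1 ^ 2 + p.2.2.1 ^ 2) ≤ 1)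

/-- Row-level comparison: termwise `≤` between two readings of one row with the same keys.
[cite: BarrettEtAl1994, §4.3.1, p. 57] -/
theorem fn_map_le_fn_map {α : Type*} (row : List α) (key : α → ℕ) (f g : α → ℝ)
    (h : ∀ p ∈ row, f p ≤ g p) (j : ℕ) :
    SRow.fn (row.map fun p => (key p, f p)) j ≤ SRow.fn (row.map fun p => (key p, g p)) j := by
  induction row with
  | nil => simp
  | cons p row ih =>
    simp only [List.map_cons, SRow.fn_cons]
    refine add_le_add ?_ (ih fun q hq => h q (List.mem_cons_of_mem _ hq))
    by_cases hk : key p = j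
    · rw [if_pos hk, if_pos hk]; exact h p (List.mem_cons_self)
    · rw [if_neg hk, if_neg hk]

/-- The rational reading of a bracket row, cast to `ℝ`, is `fn` of the cast pairs (plumbing).
[cite: BarrettEtAl1994, §4.3.1, p. 57] -/
theorem cast_fn_bracketRow (row : List (ℕ × ℚ × ℚ × ℚ)) (j : ℕ) :
    ((SRow.fn (row.map fun p => (p.1, p.2.2.2)) j : ℚ) : ℝ)
      = SRow.fn (row.map fun p => (p.1, (p.2.2.2 : ℝ))) j := by
  induction row with
  | nil => simp
  | cons p row ih =>
    simp only [List.map_cons, SRow.fn_cons, Rat.cast_add, ih]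
    congr 1
    split_ifs <;> simp

/-- A row of an `all`-checked list passes the row check (also the default row past the end). [folklore] -/
theorem row_all_of_all {β : Type*} {P : β → Bool} {L : List (List β)}
    (h : (L.all fun row => row.all P) = true) (i : ℕ) : ((L.getD i []).all P) = true := by
  rw [List.getD_eq_getElem?_getD]
  cases hL : L[i]? with
  | none => rfl
  | some r =>
    rw [Option.getD_some]
    exact (List.all_eq_true.1 h) r (List.mem_of_getElem? hL)

/-- **NO-side discharge:** `upperCheck` ⇒ `‖Y‖ ≤ w⁺` entrywise, `w⁺ = matrixOfSparseRows N N (bracketSMat ZW)`.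
[cite: GrossEtAl2019, eq. (1)] -/
theorem admittanceKernel_le_of_upperCheck (N : ℕ) (ZW : ZWRows) (h : upperCheck ZW = true) :
    ∀ i j : Fin N, admittanceKernel N ZW i j
      ≤ ((matrixOfSparseRows N N (bracketSMat ZW) i j : ℚ) : ℝ) := by
  intro i j
  have hrow := row_all_of_all h i.val
  have hget : (bracketSMat ZW).getD i.val [] = (ZW.getD i.val []).map fun p => (p.1, p.2.2.2) := by
    rw [bracketSMat, List.getD_eq_getElem?_getD, List.getElem?_map, List.getD_eq_getElem?_getD]
    cases ZW[i.val]? <;> rfl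
  rw [matrixOfSparseRows_apply, hget, cast_fn_bracketRow]
  unfold admittanceKernel admittanceRow
  refine fn_map_le_fn_map _ (fun p : ℕ × ℚ × ℚ × ℚ => p.1) _ _ (fun p hp => ?_) j.val
  have hp' := (List.all_eq_true.1 hrow) p hp
  rw [decide_eq_true_eq] at hp'
  exact admittance_le_of_check _ _ _ hp'.1 hp'.2

/-- **YES-side discharge:** `lowerCheck` ⇒ `w⁻ ≤ ‖Y‖` entrywise, `w⁻ = matrixOfSparseRows N N (bracketSMat ZW)`.
[cite: GrossEtAl2019, eq. (1)] -/
theorem le_admittanceKernel_of_lowerCheck (N : ℕ) (ZW : ZWRows) (h : lowerCheck ZW = true) :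
    ∀ i j : Fin N, ((matrixOfSparseRows N N (bracketSMat ZW) i j : ℚ) : ℝ)
      ≤ admittanceKernel N ZW i j := by
  intro i j
  have hrow := row_all_of_all h i.val
  have hget : (bracketSMat ZW).getD i.val [] = (ZW.getD i.val []).map fun p => (p.1, p.2.2.2) := by
    rw [bracketSMat, List.getD_eq_getElem?_getD, List.getElem?_map, List.getD_eq_getElem?_getD]
    cases ZW[i.val]? <;> rfl
  rw [matrixOfSparseRows_apply, hget, cast_fn_bracketRow]
  unfold admittanceKernel admittanceRow
  refine fn_map_le_fn_map _ (fun p : ℕ × ℚ × ℚ × ℚ => p.1) _ _ (fun p hp => ?_) j.val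
  have hp' := (List.all_eq_true.1 hrow) p hp
  rw [decide_eq_true_eq] at hp'
  exact le_admittance_of_check _ _ _ hp'.1 hp'.2.1 hp'.2.2

/-- **NO for the real admittance weights**, end to end: impedance list with upper brackets + test vector.
[cite: GrossEtAl2019, eq. (1); DorflerBullo2012, arXiv:0910.5673 §5.1] -/
theorem not_connectivity_certificate_admittance {N : ℕ} (ZW : ZWRows) (hup : upperCheck ZW = true)
    (hW : colsBelow N (bracketSMat ZW) = true) (v : List ℚ) (μ : ℚ)
    (hsum : ((List.range N).map fun i => v.getD i 0).sum = 0)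
    (htest : sparseEnergy2 N (bracketSMat ZW) v < 2 * μ * ((List.range N).map fun i => v.getD i 0 ^ 2).sum) :
    ¬ ∀ z : Fin N → ℝ, (μ : ℝ) * pairNormSq z
        ≤ (N : ℝ) * (1 / 2 * ∑ i, ∑ j, admittanceKernel N ZW i j * (z i - z j) ^ 2) :=
  not_connectivity_certificate_of_testVector _ hW v μ hsum htest _
    (admittanceKernel_le_of_upperCheck N ZW hup)

/-- **YES for the real admittance weights**, end to end: impedance list with lower brackets + the sparse
grounded certificate of the bracket matrix. [cite: GrossEtAl2019, eq. (1); ZhengFantuzziPapachristodoulou2018, §3.2 Theorem 2 («if» direction)] -/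
theorem connectivity_certificate_admittance {m d : ℕ} (ZW : ZWRows) (hlo : lowerCheck ZW = true)
    (hd : m + 1 ≤ 2 ^ d) (hW : colsBelow (m + 1) (bracketSMat ZW) = true)
    (hsym : SMat.eqCheck (m + 1) (bracketSMat ZW) (SMat.transpose d (m + 1) (bracketSMat ZW)) = true)
    (g : Fin (m + 1)) (lam : ℚ) (hlam : 0 ≤ lam) (bs : List (Block m ℚ))
    (hsweep : cliqueSweepS m 0 m (groundedSMatIn m (bracketSMat ZW) g.val lam) bs = true)
    (hldl : ldlAll bs = true) :
    ∀ z : Fin (m + 1) → ℝ, (lam : ℝ) * pairNormSq z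
      ≤ ((m + 1 : ℕ) : ℝ) * (1 / 2 * ∑ i, ∑ j, admittanceKernel (m + 1) ZW i j * (z i - z j) ^ 2) :=
  connectivity_certificate_of_le_weights _ _ (le_admittanceKernel_of_lowerCheck (m + 1) ZW hlo) _
    (connectivity_certificate_of_grounded_smatIn (bracketSMat ZW) hd hW hsym g lam hlam bs hsweep hldl)

/-! ## A symmetric reading for consumers that require `w k j = w j k`

`DvocReduced.decreaseOnS_of_condition2` / `_of_nodewise` take `hsym : ∀ k j, W.w k j = W.w j k`. The row-wise kernel
`admittanceKernel` is symmetric only if the typed rows are (both directions, same `r, x`, no parallel lines); rather than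
deciding that structurally, a YES-instance can read the SYMMETRISED kernel `½(aᵢⱼ + aⱼᵢ)` — equal to `a` on symmetric data,
symmetric by construction, nonnegative, and still bracketed from below by a symmetric bracket matrix. -/

/-- The symmetrised admittance kernel `½(‖Yᵢⱼ‖ + ‖Yⱼᵢ‖)` (= `‖Yᵢⱼ‖` on symmetrically typed data). [cite: GrossEtAl2019, eq. (1)] -/
noncomputable def admittanceKernelSym (N : ℕ) (ZW : ZWRows) : Fin N → Fin N → ℝ :=
  fun i j => (admittanceKernel N ZW i j + admittanceKernel N ZW j i) / 2

/-- `admittanceKernelSym` is symmetric. [folklore] -/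
theorem admittanceKernelSym_symm (N : ℕ) (ZW : ZWRows) (i j : Fin N) :
    admittanceKernelSym N ZW i j = admittanceKernelSym N ZW j i := by
  unfold admittanceKernelSym; ring

/-- Rows of admittances read nonnegatively (plumbing for the kernels). [cite: GrossEtAl2019, eq. (1)] -/
theorem fn_admittanceRow_nonneg (row : List (ℕ × ℚ × ℚ × ℚ)) (j : ℕ) : 0 ≤ SRow.fn (admittanceRow row) j := by
  unfold admittanceRow
  induction row with
  | nil => simp
  | cons p row ih =>
    rw [List.map_cons, SRow.fn_cons]
    refine add_nonneg ?_ ih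
    split_ifs
    · exact admittance_nonneg _ _
    · exact le_rfl

/-- `admittanceKernelSym` is entrywise nonnegative. [folklore] -/
theorem admittanceKernelSym_nonneg (N : ℕ) (ZW : ZWRows) (i j : Fin N) : 0 ≤ admittanceKernelSym N ZW i j := by
  unfold admittanceKernelSym admittanceKernel
  exact div_nonneg (add_nonneg (fn_admittanceRow_nonneg _ _) (fn_admittanceRow_nonneg _ _)) (by norm_num)

/-- **Lower brackets transfer to the symmetrised kernel** when the bracket matrix itself is symmetric (the YES files
decide that as `SMat.eqCheck N (bracketSMat ZW) (SMat.transpose d N (bracketSMat ZW))`). [cite: GrossEtAl2019, eq. (1)] -/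
theorem le_admittanceKernelSym_of_lowerCheck {N d : ℕ} (ZW : ZWRows) (h : lowerCheck ZW = true) (hd : N ≤ 2 ^ d)
    (hsym : SMat.eqCheck N (bracketSMat ZW) (SMat.transpose d N (bracketSMat ZW)) = true) :
    ∀ i j : Fin N, ((matrixOfSparseRows N N (bracketSMat ZW) i j : ℚ) : ℝ) ≤ admittanceKernelSym N ZW i j := by
  intro i j
  have h1 := le_admittanceKernel_of_lowerCheck N ZW h i j
  have h2 := le_admittanceKernel_of_lowerCheck N ZW h j i
  have hs : matrixOfSparseRows N N (bracketSMat ZW) j i = matrixOfSparseRows N N (bracketSMat ZW) i j :=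
    (symm_of_eqCheck_transpose hd _ hsym i j).symm
  rw [hs] at h2
  unfold admittanceKernelSym
  linarith

/-- **YES for the symmetrised real admittance weights** (the reading a `DvocReduced` record with `hsym` wants): the sparse
grounded certificate of the bracket matrix transfers by monotonicity. [cite: GrossEtAl2019, eq. (1); ZhengFantuzziPapachristodoulou2018, §3.2 Theorem 2 («if» direction)] -/
theorem connectivity_certificate_admittanceSym {m d : ℕ} (ZW : ZWRows) (hlo : lowerCheck ZW = true)
    (hd : m + 1 ≤ 2 ^ d) (hW : colsBelow (m + 1) (bracketSMat ZW) = true)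
    (hsym : SMat.eqCheck (m + 1) (bracketSMat ZW) (SMat.transpose d (m + 1) (bracketSMat ZW)) = true)
    (g : Fin (m + 1)) (lam : ℚ) (hlam : 0 ≤ lam) (bs : List (Block m ℚ))
    (hsweep : cliqueSweepS m 0 m (groundedSMatIn m (bracketSMat ZW) g.val lam) bs = true)
    (hldl : ldlAll bs = true) :
    ∀ z : Fin (m + 1) → ℝ, (lam : ℝ) * pairNormSq z
      ≤ ((m + 1 : ℕ) : ℝ) * (1 / 2 * ∑ i, ∑ j, admittanceKernelSym (m + 1) ZW i j * (z i - z j) ^ 2) :=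
  connectivity_certificate_of_le_weights _ _ (le_admittanceKernelSym_of_lowerCheck ZW hlo hd hsym) _
    (connectivity_certificate_of_grounded_smatIn (bracketSMat ZW) hd hW hsym g lam hlam bs hsweep hldl)

end Summit.Ventures.GridStability.Lyapunov
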